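import Summits.QuantumFields.YangMills.Theorems.MirrorModularBoostsSoftKernelBoostCovarianceOfInputs
import Summits.QuantumFields.YangMills.Theorems.MirrorModularBoostsSoftKernelBoostCovarianceStepZeroOfLattice
import Summits.QuantumFields.YangMills.Theorems.PencilRigidityNPointIsotropyCoreCertificate
import HarnessLib

/-!
# `PencilRigidity.NPointIsotropy`: planar invariance of ONE family from its RADIAL inputs (generation 12 of line
`complex-rotation-bandlimit`, crux stmt-QuantumFields-11686; registered stub `stub_planarInvariantOfInputsRadial`)

The sibling crux stmt-QuantumFields-14999 (`MirrorModularBoosts.SoftKernelBoostCovariance`, line `Sketch`) landed the complete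
model-blind operator chain that turns the transversely filtered heat-sandwich bound Σ into uniform planar boost vectors
(`stub_asmUniformBoost`) and, below the threshold `μ < 4`, into typed boost vectors (`stub_asmTypedBoost`) whose growth kills the
layers `|k| ≥ 2` of the diagonal doubled pencils (`stub_levelGrowthHigh_of_boostType` + `stub_laurentLayers`); its pointwise
composition `stub_planarInvariantOfInputs` consumes the soft two-point kernel triple in exactly one place besides Σ's antecedent —
level growth at levels `a ≤ 1`.  On crux 11686 the two-point kernel is RADIAL by hypothesis, and that step is the landed
`ComplexRotationBandlimit.levelGrowthLow_shape` (`Theorems/PencilRigidityNPointIsotropyCoreCertificate.lean`).  This file records: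

* `stub_planarInvariantOfInputsRadial` — for ONE one-species family `S₁`: OS package, translations, proper-hypercubic invariance,
  the eight planar frames, the planar cone, the RADIAL kernel, `NPointRegular S₁`, an `e₀`-sandwich bound with some exponent
  `μ < 4` for every `e₀`-reconstruction of `S₁`, and a sandwich bound with SOME exponent (no threshold) for every
  `e₀`-reconstruction of the `45°` pull-back, imply `PlanarInvariant S₁` (registered signature verbatim);
* `nPointIsotropy_of_stepZero_sigmaRadial` — the crux `PencilRigidity.NPointIsotropy` BY NAME from Step 0 in the shared form
  (`W1 → EightFrameRP → PlanarCone → NPointRegular`, = item stmt-QuantumFields-17723) and Σ asked of the crux's families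
  (`W1 → EightFrameRP → RadialKernel → Σ_e₀(μ<4) ∧ Σ_45°(any)`, the registered `stub_sandwichBoundRadial`);
* `nPointIsotropy_of_T_sigmaRadial` — the same with Step 0 replaced by the shared lattice residual T
  (`stub_temperedLatticeApproximants` = item stmt-QuantumFields-17721), through the landed glue `stub_stepZeroOfLattice`.

References: K. Osterwalder, R. Schrader, Comm. Math. Phys. 42 (1975) 281–305, Ch. V (boost/continuation bookkeeping);
J. Glimm, A. Jaffe, Quantum Physics (1987) §19.5–19.7 (heat-kernel sandwich estimates). [folklore]
-/

noncomputable section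

namespace Summit.QuantumFields.YangMills.Theorems.NPointIsotropy.ComplexRotationBandlimit

open scoped BigOperators SchwartzMap InnerProductSpace
open MeasureTheory Filter Topology
open Literature.MathematicalPhysics.QuantumLattice Literature.MathematicalPhysics.AQFT
  Literature.MathematicalPhysics.QuantumFieldTheory
open Summit.QuantumFields.YangMills.Theorems.NPointIsotropy.Negative (E4 NPointRegular RadialKernel nPointIsotropy_iff)
open Summit.QuantumFields.YangMills.Theorems.CurvatureBoostCovariance.Negative
  (OSPackage Translations Hypercubic EightFrameRP PlanarCone PlanarInvariant Tie Gaps W1)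
open Summit.QuantumFields.YangMills.Theorems.CurvatureBoostCovariance.BoostsInheritMirrors.RayPositivity
  (osReconstruction_of translations_pullBack isSymmetric_pullBack hasLinearGrowth_pullBack isReflectionPositive_pullBack
    eightFrameRP_pullBack planarCone_pullBack)
open Summit.QuantumFields.YangMills.Theorems.SoftKernelBoostCovariance.Sketch
  (stub_coneFamily sandwich_mono_exponent stub_asmUniformBoost stub_asmTypedBoost stub_orbitBandlimitLocal
    stub_rayPositivityLocal boostVectors_of_uniform stub_levelGrowthHigh_of_boostType stub_laurentLayers sieve_of_stubs
    stub_stepZeroOfLattice)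

/-- **PLANAR INVARIANCE OF ONE FAMILY FROM ITS RADIAL INPUTS (registered stub `stub_planarInvariantOfInputsRadial` of crux
stmt-QuantumFields-11686, generation 12).**  For a one-species family `S₁` on `ℝ⁴` with the OS package, translations and
proper-hypercubic invariance on `⁰𝒮`, reflection positivity in the eight planar frames, the planar spectral cone and the RADIAL
two-point kernel: IF every `𝔖ₙ|⁰𝒮` is a function (`NPointRegular S₁`), the `e₀`-sandwich bound holds with SOME exponent `μ < 4` for
every `e₀`-reconstruction of `S₁`, and a sandwich bound with SOME exponent holds for every `e₀`-reconstruction of the `45°` pull-back,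
THEN `S₁` is invariant on `⁰𝒮` under every rotation of the `(x₀,x₁)`-plane.  Proof = 14999's landed chain: reconstructions
(`osReconstruction_of`, `*_pullBack`, `PlanarSpectralCone_of`), cone families (`stub_coneFamily`), `sandwich_mono_exponent`, uniform
and typed boost vectors (`stub_asmUniformBoost`, `stub_asmTypedBoost`), band limit and ray positivity (`stub_orbitBandlimitLocal`,
`stub_rayPositivityLocal`), level growth (`levelGrowthLow_shape` from the radial kernel at levels `≤ 1`;
`stub_levelGrowthHigh_of_boostType` + `stub_laurentLayers` at levels `≥ 2`) and the parity sieve (`sieve_of_stubs`). -/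
theorem stub_planarInvariantOfInputsRadial :
    open Literature.MathematicalPhysics.QuantumLattice Literature.MathematicalPhysics.AQFT
      Literature.MathematicalPhysics.QuantumFieldTheory
      Summit.QuantumFields.YangMills.Theorems.CurvatureBoostCovariance.Negative
      Summit.QuantumFields.YangMills.Theorems.NPointIsotropy.Negative in
    ∀ (S₁ : SchwingerFamily E4), OSPackage S₁ → Translations S₁ → Hypercubic S₁ → EightFrameRP S₁ → PlanarCone S₁ →
      RadialKernel S₁ → NPointRegular S₁ →
      (∀ (h : OSReconstructionNoE1 S₁.toLabelled), ∃ μ C : ℝ, μ < 4 ∧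
        (∀ (u v : ℝ), 0 < u → 0 < v → u ≤ 1 → v ≤ 1 →
           ∀ (f₁ : SchwartzMap (Fin 1 → E4) ℂ) (g hh : ℝ × ℝ → ℂ) (Mg Mh Mh' : ℝ),
             (∀ x : Fin 1 → E4, f₁ x = g (x 0 0, x 0 1) * hh (x 0 2, x 0 3)) →
             (∀ p : ℝ × ℝ, g p ≠ 0 → u ≤ p.1 ∧ p.1 ≤ 2 * u) →
             MeasureTheory.Integrable g → (∫ p, ‖g p‖) ≤ Mg →
             MeasureTheory.Integrable hh → (∫ p, ‖hh p‖) ≤ Mh → (∀ p, ‖hh p‖ ≤ Mh') →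
           ∀ (n : ℕ) (W : SchwartzMap (Fin n → E4) ℂ) (hW : IsTimeOrdered W)
             (hFW : IsTimeOrdered
               (SchwartzMap.appendTensor f₁ (translateMulti ((2 * u + v) • EuclideanSpace.single 0 1) W))),
             ‖h.fieldVec (1 + n) (fun _ => ())
                 (SchwartzMap.appendTensor f₁ (translateMulti ((2 * u + v) • EuclideanSpace.single 0 1) W)) hFW‖
               ≤ C * Mg * (Mh + Mh') * (u ^ (-μ) + v ^ (-μ)) * ‖h.fieldVec n (fun _ => ()) W hW‖)) →
      (∀ (h' : OSReconstructionNoE1 (SchwingerFamily.toLabelled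
          (fun n => (S₁ n).comp (linActMulti (planeRot (0 : Fin 3) (Real.pi / 4)))))),
        ∃ μ C : ℝ,
        (∀ (u v : ℝ), 0 < u → 0 < v → u ≤ 1 → v ≤ 1 →
           ∀ (f₁ : SchwartzMap (Fin 1 → E4) ℂ) (g hh : ℝ × ℝ → ℂ) (Mg Mh Mh' : ℝ),
             (∀ x : Fin 1 → E4, f₁ x = g (x 0 0, x 0 1) * hh (x 0 2, x 0 3)) →
             (∀ p : ℝ × ℝ, g p ≠ 0 → u ≤ p.1 ∧ p.1 ≤ 2 * u) →
             MeasureTheory.Integrable g → (∫ p, ‖g p‖) ≤ Mg →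
             MeasureTheory.Integrable hh → (∫ p, ‖hh p‖) ≤ Mh → (∀ p, ‖hh p‖ ≤ Mh') →
           ∀ (n : ℕ) (W : SchwartzMap (Fin n → E4) ℂ) (hW : IsTimeOrdered W)
             (hFW : IsTimeOrdered
               (SchwartzMap.appendTensor f₁ (translateMulti ((2 * u + v) • EuclideanSpace.single 0 1) W))),
             ‖h'.fieldVec (1 + n) (fun _ => ())
                 (SchwartzMap.appendTensor f₁ (translateMulti ((2 * u + v) • EuclideanSpace.single 0 1) W)) hFW‖
               ≤ C * Mg * (Mh + Mh') * (u ^ (-μ) + v ^ (-μ)) * ‖h'.fieldVec n (fun _ => ()) W hW‖)) →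
      PlanarInvariant S₁ := by
  intro S₁ hOS htr hhyp h8 hC hK hreg hSig hSigT
  have hlow := levelGrowthLow_shape (S₁ := S₁) hK
  have hlg := hOS.2.2.1
  have hRP := hOS.2.2.2.1
  have hsym := hOS.2.2.2.2.1
  -- the two reconstructions
  have h : OSReconstructionNoE1 S₁.toLabelled := osReconstruction_of hRP htr
  have hT : OSReconstructionNoE1 (SchwingerFamily.toLabelled
      (fun n => (S₁ n).comp (linActMulti (planeRot (0 : Fin 3) (Real.pi / 4))))) :=
    osReconstruction_of (isReflectionPositive_pullBack h8) (translations_pullBack htr _)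
  have hPSC : Summit.QuantumFields.YangMills.Theses.MirrorModularBoosts.PlanarSpectralCone :=
    Summit.QuantumFields.YangMills.Cruxes.PlanarSpectralCone.PositivityDiscToOperatorCone.PlanarSpectralCone_of
  -- cone families
  have hN := stub_coneFamily S₁ h hlg hsym htr h8
  have hNT := stub_coneFamily (fun n => (S₁ n).comp (linActMulti (planeRot (0 : Fin 3) (Real.pi / 4)))) hT
    (hasLinearGrowth_pullBack hlg _) (isSymmetric_pullBack hsym _) (translations_pullBack htr _) (eightFrameRP_pullBack h8)
  -- the sandwich bounds (the YM input), the `e₀` exponent made nonnegative (`sandwich_mono_exponent`)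
  obtain ⟨μ₀, Cμ, hμ₀, hS₀⟩ := hSig h
  obtain ⟨μT₀, CμT, hST⟩ := hSigT hT
  have hS := sandwich_mono_exponent h hS₀
  have hμ : max μ₀ 0 < 4 := max_lt hμ₀ (by norm_num)
  -- the chain, for `S₁` (uniform + typed) and for the pull-back (uniform, any exponent)
  have huni := stub_asmUniformBoost S₁ h hlg hsym htr h8 hC hN (max μ₀ 0) Cμ hS
  have hsub := stub_asmTypedBoost S₁ h hlg hsym htr h8 hC hN (max μ₀ 0) Cμ hS (le_max_right _ _)
  have huniT := stub_asmUniformBoost (fun n => (S₁ n).comp (linActMulti (planeRot (0 : Fin 3) (Real.pi / 4)))) hT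
    (hasLinearGrowth_pullBack hlg _) (isSymmetric_pullBack hsym _) (translations_pullBack htr _) (eightFrameRP_pullBack h8)
    (planarCone_pullBack hPSC hlg hsym htr h8) hNT μT₀ CμT hST
  -- band limit and ray positivity from the local stubs
  have hband := stub_orbitBandlimitLocal S₁ hOS htr hhyp h8 hC hreg (fun _ => huni)
  have hpos := stub_rayPositivityLocal S₁ hOS htr h8 (fun _ => boostVectors_of_uniform h huni)
    (fun _ => boostVectors_of_uniform hT huniT)
  -- level growth at every level
  have hgrow : ∀ a : ℕ,
      (∀ N : ℕ, N + 2 ≤ 2 * a → ∀ R : E4 ≃ₗᵢ[ℝ] E4,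
            LinearMap.det (R.toLinearEquiv : E4 →ₗ[ℝ] E4) = 1 →
            R (EuclideanSpace.single 2 1) = EuclideanSpace.single 2 1 →
            R (EuclideanSpace.single 3 1) = EuclideanSpace.single 3 1 →
            ∀ F : SchwartzMap (Fin N → E4) ℂ, IsOffDiagonal F → S₁ N (linActMulti R F) = S₁ N F) →
      ∀ (F : 𝓢((Fin a → E4), ℂ)), IsTimeOrdered F → HasCompactSupport (F : (Fin a → E4) → ℂ) →
      ∀ H : 𝓢((Fin (a + a) → E4), ℂ), IsAppendTensorOf H (osAdjoint F) F →
      ∀ (K : ℕ) (p : ℤ → ℂ),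
        (∀ θ : ℝ, S₁ (a + a) (linActMulti (planeRot (0 : Fin 3) θ) H) =
          ∑ k ∈ Finset.Icc (-(K : ℤ)) K, p k * Complex.exp (4 * (k : ℂ) * (θ : ℂ) * Complex.I)) →
        ∀ k ∈ Finset.Icc (-(K : ℤ)) K, 2 ≤ |k| → p k = 0 := by
    intro a hInv F hF hFc H hH K p hp
    by_cases ha : a ≤ 1
    · exact hlow a ha hInv F hF hFc H hH K p hp
    · obtain ⟨ε, hε, V, C', hVd, hVg, hVeq⟩ := hsub a (by omega) hInv F hF hFc
      exact stub_levelGrowthHigh_of_boostType stub_laurentLayers S₁ h a F hF hFc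
        ⟨ε, hε, V, C', max μ₀ 0, hμ, hVd, hVg, hVeq⟩ H hH K p hp
  exact sieve_of_stubs S₁ hOS htr hreg hband hpos hgrow

/-- **THE CRUX FROM STEP 0 AND Σ_radial, BY NAME.**  Step 0 in the shared form (`W1 → EightFrameRP → PlanarCone → NPointRegular`,
for every compact simple `G` with any Borel structure — item stmt-QuantumFields-17723 `IsotropyFromPowerCounting.CurvatureDensities`)
and the sandwich bound asked of the crux's families (`W1 → EightFrameRP → RadialKernel → Σ_e₀(μ < 4) ∧ Σ_45°(any)`, the registered
`stub_sandwichBoundRadial` of crux 11686) imply `PencilRigidity.NPointIsotropy`: the cone is the landed 9664 theorem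
(`planarCone_of_W1`), the rest is `stub_planarInvariantOfInputsRadial`. -/
theorem nPointIsotropy_of_stepZero_sigmaRadial
    (h0 : ∀ (G : Type) [Group G] [TopologicalSpace G] [IsTopologicalGroup G] [CompactSpace G]
       [MeasurableSpace G] [BorelSpace G], IsCompactSimpleLieGroup G →
       ∀ (r : LatticeRep G) (sch : SpeciesScheme (YMSpecies G)) (S₁ : SchwingerFamily E4),
         W1 r sch S₁ → EightFrameRP S₁ → PlanarCone S₁ → NPointRegular S₁)
    (hSig0 : ∀ (G : Type) [Group G] [TopologicalSpace G] [IsTopologicalGroup G] [CompactSpace G]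
      [MeasurableSpace G] [BorelSpace G], IsCompactSimpleLieGroup G →
      ∀ (r : LatticeRep G) (sch : SpeciesScheme (YMSpecies G)) (S₁ : SchwingerFamily E4),
        W1 r sch S₁ → EightFrameRP S₁ → RadialKernel S₁ →
        (∀ (h : OSReconstructionNoE1 S₁.toLabelled), ∃ μ C : ℝ, μ < 4 ∧
          (∀ (u v : ℝ), 0 < u → 0 < v → u ≤ 1 → v ≤ 1 →
             ∀ (f₁ : 𝓢((Fin 1 → E4), ℂ)) (g hh : ℝ × ℝ → ℂ) (Mg Mh Mh' : ℝ),
               (∀ x : Fin 1 → E4, f₁ x = g (x 0 0, x 0 1) * hh (x 0 2, x 0 3)) →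
               (∀ p : ℝ × ℝ, g p ≠ 0 → u ≤ p.1 ∧ p.1 ≤ 2 * u) →
               MeasureTheory.Integrable g → (∫ p, ‖g p‖) ≤ Mg →
               MeasureTheory.Integrable hh → (∫ p, ‖hh p‖) ≤ Mh → (∀ p, ‖hh p‖ ≤ Mh') →
             ∀ (n : ℕ) (W : 𝓢((Fin n → E4), ℂ)) (hW : IsTimeOrdered W)
               (hFW : IsTimeOrdered
                 (SchwartzMap.appendTensor f₁ (translateMulti ((2 * u + v) • EuclideanSpace.single 0 1) W))),
               ‖h.fieldVec (1 + n) (fun _ => ())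
                   (SchwartzMap.appendTensor f₁ (translateMulti ((2 * u + v) • EuclideanSpace.single 0 1) W)) hFW‖
                 ≤ C * Mg * (Mh + Mh') * (u ^ (-μ) + v ^ (-μ)) * ‖h.fieldVec n (fun _ => ()) W hW‖)) ∧
        (∀ (h' : OSReconstructionNoE1 (SchwingerFamily.toLabelled
            (fun n => (S₁ n).comp (linActMulti (planeRot (0 : Fin 3) (Real.pi / 4)))))),
          ∃ μ C : ℝ,
          (∀ (u v : ℝ), 0 < u → 0 < v → u ≤ 1 → v ≤ 1 →
             ∀ (f₁ : 𝓢((Fin 1 → E4), ℂ)) (g hh : ℝ × ℝ → ℂ) (Mg Mh Mh' : ℝ),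
               (∀ x : Fin 1 → E4, f₁ x = g (x 0 0, x 0 1) * hh (x 0 2, x 0 3)) →
               (∀ p : ℝ × ℝ, g p ≠ 0 → u ≤ p.1 ∧ p.1 ≤ 2 * u) →
               MeasureTheory.Integrable g → (∫ p, ‖g p‖) ≤ Mg →
               MeasureTheory.Integrable hh → (∫ p, ‖hh p‖) ≤ Mh → (∀ p, ‖hh p‖ ≤ Mh') →
             ∀ (n : ℕ) (W : 𝓢((Fin n → E4), ℂ)) (hW : IsTimeOrdered W)
               (hFW : IsTimeOrdered
                 (SchwartzMap.appendTensor f₁ (translateMulti ((2 * u + v) • EuclideanSpace.single 0 1) W))),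
               ‖h'.fieldVec (1 + n) (fun _ => ())
                   (SchwartzMap.appendTensor f₁ (translateMulti ((2 * u + v) • EuclideanSpace.single 0 1) W)) hFW‖
                 ≤ C * Mg * (Mh + Mh') * (u ^ (-μ) + v ^ (-μ)) * ‖h'.fieldVec n (fun _ => ()) W hW‖))) :
    Summit.QuantumFields.YangMills.Theses.PencilRigidity.NPointIsotropy := by
  rw [nPointIsotropy_iff]
  intro G _ _ _ _ hG
  letI : MeasurableSpace G := borel G
  haveI : BorelSpace G := ⟨rfl⟩
  intro r sch S₁ hW h8 hK
  have hC : PlanarCone S₁ := planarCone_of_W1 hW h8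
  have hreg : NPointRegular S₁ := h0 G hG r sch S₁ hW h8 hC
  obtain ⟨hSig, hSigT⟩ := hSig0 G hG r sch S₁ hW h8 hK
  obtain ⟨-, hOS, htr, hhyp, -⟩ := hW
  exact stub_planarInvariantOfInputsRadial S₁ hOS htr hhyp h8 hC hK hreg hSig hSigT

/-- **THE CRUX FROM T AND Σ_radial, BY NAME** — the same with Step 0 supplied by the shared lattice residual T (the registered
`stub_temperedLatticeApproximants` = item stmt-QuantumFields-17721 `IsotropyFromPowerCounting.TemperedCurvatureMoments`) through
14999's landed glue `stub_stepZeroOfLattice` (normalisation from `W1`).  This is the generation-12 reduction of crux 11686: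
`T ∧ Σ_radial ⇒ NPointIsotropy`. -/
theorem nPointIsotropy_of_T_sigmaRadial
    (hT : ∀ (G : Type) [Group G] [TopologicalSpace G] [IsTopologicalGroup G] [CompactSpace G]
      [MeasurableSpace G] [BorelSpace G], IsCompactSimpleLieGroup G →
      ∀ (r : LatticeRep G) (sch : SpeciesScheme (YMSpecies G)) (S₁ : SchwingerFamily E4),
        W1 r sch S₁ → EightFrameRP S₁ → PlanarCone S₁ →
        ∀ n : ℕ, 0 < n → ∃ (D : ℕ → (Fin n → Literature.Probability.LatticeModels.Site 4) → ℝ) (C : ℝ) (N k₀ : ℕ),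
          0 < C ∧
          (∀ k : ℕ, k₀ ≤ k → ∀ x : Fin n → Literature.Probability.LatticeModels.Site 4,
            (∀ i, x i ∈ Literature.Probability.LatticeModels.box 4 (sch.L k)) → Function.Injective x →
            |D k x| ≤ C * (1 + ‖fun i => sch.a k • siteToE (x i)‖) ^ N *
              (1 + ∑ i, ∑ j ∈ Finset.univ.erase i,
                ‖sch.a k • siteToE (x i) - sch.a k • siteToE (x j)‖⁻¹) ^ N) ∧
          ∀ (f : Fin n → 𝓢(E4, ℝ)) (F : 𝓢((Fin n → E4), ℂ)),
            IsTensorOf F (fun i => ofRealTest (f i)) → IsOffDiagonal F →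
            Filter.Tendsto (fun k => (((sch.a k ^ 4) ^ n *
              ∑ x ∈ Fintype.piFinset (fun _ : Fin n => Literature.Probability.LatticeModels.box 4 (sch.L k)),
                (∏ i, f i (sch.a k • siteToE (x i))) * D k x : ℝ) : ℂ)) Filter.atTop (nhds (S₁ n F)))
    (hSig0 : ∀ (G : Type) [Group G] [TopologicalSpace G] [IsTopologicalGroup G] [CompactSpace G]
      [MeasurableSpace G] [BorelSpace G], IsCompactSimpleLieGroup G →
      ∀ (r : LatticeRep G) (sch : SpeciesScheme (YMSpecies G)) (S₁ : SchwingerFamily E4),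
        W1 r sch S₁ → EightFrameRP S₁ → RadialKernel S₁ →
        (∀ (h : OSReconstructionNoE1 S₁.toLabelled), ∃ μ C : ℝ, μ < 4 ∧
          (∀ (u v : ℝ), 0 < u → 0 < v → u ≤ 1 → v ≤ 1 →
             ∀ (f₁ : 𝓢((Fin 1 → E4), ℂ)) (g hh : ℝ × ℝ → ℂ) (Mg Mh Mh' : ℝ),
               (∀ x : Fin 1 → E4, f₁ x = g (x 0 0, x 0 1) * hh (x 0 2, x 0 3)) →
               (∀ p : ℝ × ℝ, g p ≠ 0 → u ≤ p.1 ∧ p.1 ≤ 2 * u) →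
               MeasureTheory.Integrable g → (∫ p, ‖g p‖) ≤ Mg →
               MeasureTheory.Integrable hh → (∫ p, ‖hh p‖) ≤ Mh → (∀ p, ‖hh p‖ ≤ Mh') →
             ∀ (n : ℕ) (W : 𝓢((Fin n → E4), ℂ)) (hW : IsTimeOrdered W)
               (hFW : IsTimeOrdered
                 (SchwartzMap.appendTensor f₁ (translateMulti ((2 * u + v) • EuclideanSpace.single 0 1) W))),
               ‖h.fieldVec (1 + n) (fun _ => ())
                   (SchwartzMap.appendTensor f₁ (translateMulti ((2 * u + v) • EuclideanSpace.single 0 1) W)) hFW‖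
                 ≤ C * Mg * (Mh + Mh') * (u ^ (-μ) + v ^ (-μ)) * ‖h.fieldVec n (fun _ => ()) W hW‖)) ∧
        (∀ (h' : OSReconstructionNoE1 (SchwingerFamily.toLabelled
            (fun n => (S₁ n).comp (linActMulti (planeRot (0 : Fin 3) (Real.pi / 4)))))),
          ∃ μ C : ℝ,
          (∀ (u v : ℝ), 0 < u → 0 < v → u ≤ 1 → v ≤ 1 →
             ∀ (f₁ : 𝓢((Fin 1 → E4), ℂ)) (g hh : ℝ × ℝ → ℂ) (Mg Mh Mh' : ℝ),
               (∀ x : Fin 1 → E4, f₁ x = g (x 0 0, x 0 1) * hh (x 0 2, x 0 3)) →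
               (∀ p : ℝ × ℝ, g p ≠ 0 → u ≤ p.1 ∧ p.1 ≤ 2 * u) →
               MeasureTheory.Integrable g → (∫ p, ‖g p‖) ≤ Mg →
               MeasureTheory.Integrable hh → (∫ p, ‖hh p‖) ≤ Mh → (∀ p, ‖hh p‖ ≤ Mh') →
             ∀ (n : ℕ) (W : 𝓢((Fin n → E4), ℂ)) (hW : IsTimeOrdered W)
               (hFW : IsTimeOrdered
                 (SchwartzMap.appendTensor f₁ (translateMulti ((2 * u + v) • EuclideanSpace.single 0 1) W))),
               ‖h'.fieldVec (1 + n) (fun _ => ())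
                   (SchwartzMap.appendTensor f₁ (translateMulti ((2 * u + v) • EuclideanSpace.single 0 1) W)) hFW‖
                 ≤ C * Mg * (Mh + Mh') * (u ^ (-μ) + v ^ (-μ)) * ‖h'.fieldVec n (fun _ => ()) W hW‖))) :
    Summit.QuantumFields.YangMills.Theses.PencilRigidity.NPointIsotropy :=
  nPointIsotropy_of_stepZero_sigmaRadial
    (fun G _ _ _ _ _ _ hG r sch S₁ hW h8 hC =>
      stub_stepZeroOfLattice sch.a sch.L S₁ sch.a_pos sch.tendsto_a sch.tendsto_L hW.2.1.1
        (fun n hn => hT G hG r sch S₁ hW h8 hC n hn))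
    hSig0

end Summit.QuantumFields.YangMills.Theorems.NPointIsotropy.ComplexRotationBandlimit

end
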